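import Literature.Probability.Percolation.CorrelationLengthDKTProp5
import HarnessLib

/-!
# QUANT lane (p4 gen 20): DEFINITIONS — the Bernoulli first-passage times `T_n` (origin to `∂Λ_n`) and `ρ`
# (origin to infinity) of bond percolation on `ℤ^d`, through their layer-cake events

builds on p205010 (kernel theorem, internal audit signed; external expert review pending) — NOT used in this file
(definitions only).

Seat `prim-quant-p4` (METHOD = differential inequalities for `θ` near `p_c`).  Objects for the exponential-steepness
files `…QuantOneArmSteepness` / `…QuantPassageTimeCritical` (Grimmett–Piza's `d/dp log P_p(A) ≥ E_p[H_A]/(p(1−p))`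
applied to the one-arm event `A_n = {0 ↔ ∂Λ_n}`).  For `A_n` the Hamming distance `H_{A_n}` of Grimmett 2006 (2.51)
is the **first-passage time** `T_n = T(0, ∂Λ_n)` of FIRST-PASSAGE PERCOLATION with Bernoulli passage times
`t_e = 𝟙[e closed]` (`P(t_e = 0) = p`): the minimal number of closed edges on a lattice path from the origin to `∂Λ_n`
inside `Λ_n` (Grimmett 2006, §3.5: "`H_A` is the minimum number of closed edges amongst the family of all paths from `S`
to `T`"), and `ρ = lim_n T_n` is the **passage time to infinity** of Zhang / Auffinger–Damron–Hanson §3.7.1 (eq. (3.25)).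
We work with the layer-cake EVENTS (no random variables):

* `passTimeLE d n k` = `{T_n ≤ k}`: the arm event `DKT20.armEvent 0 n` (`0 ↔ ∂ⁱⁿΛ_n` by lattice steps inside `Λ_n`)
  occurs after opening at most `k` further lattice edges inside `Λ_n` — this is
  `Steepness.withinDist (edgesIn (zdGraph d) (box d n)) (DKT20.armEvent 0 n) k` of
  `Literature/Probability/Percolation/PercolationSteepness.lean`, spelled out;
* `meanPassTime d n p` = `E_p[T_n] = Σ_{k < |F_n|} P_p(T_n > k)` (`F_n` = lattice edges inside `Λ_n`; `T_n ≤ |F_n|`);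
* `rhoLE d k` = `{ρ ≤ k} = ⋂_n {T_n ≤ k}` (the events `{T_n ≤ k}` decrease in `n`);
* `meanRhoUpTo d K p` = `Σ_{k<K} P_p(ρ > k)`, the partial sums of `E_p[ρ] = Σ_k P_p(ρ > k) ∈ [0, ∞]`.

## References
* A. Auffinger, M. Damron, J. Hanson, *50 Years of First-Passage Percolation*, AMS University Lecture Series 68 (2017),
  §3.7.1 "Critical first-passage percolation", eq. (3.25) (`ρ = lim_n T(0, ∂B(n))`) [AuffingerDamronHanson2017].
* H. Kesten, *Aspects of first passage percolation*, Saint-Flour XIV (1984), LNM 1180 (1986), §6 [KestenAspects1986].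
* G. Grimmett, *The Random-Cluster Model*, Springer 2006, §2.5 (2.51)–(2.52), §3.5 [GrimmettRandomCluster2006].
-/

noncomputable section

namespace Summit.CriticalPhenomena.PercolationContinuityZ3.Theorems

namespace PassTime

open MeasureTheory Literature.Probability.Percolation Literature.Probability.LatticeModels

/-- **`{T_n ≤ k}`**: the configurations in which the origin is joined to `∂ⁱⁿΛ_n` by lattice steps inside `Λ_n` after at
most `k` further lattice edges inside `Λ_n` are declared open — i.e. the Bernoulli first-passage time
`T_n = min{#closed edges on π : π a lattice path 0 → ∂Λ_n in Λ_n}` is at most `k` (the sub-level set `{H_{A_n} ≤ k}` of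
Grimmett's Hamming distance to the arm event `A_n = DKT20.armEvent 0 n`).
[cite: GrimmettRandomCluster2006, §2.5 (2.51)–(2.52) and §3.5] [cite: AuffingerDamronHanson2017, §3.7.1] -/
def passTimeLE (d n k : ℕ) : Set (BondConfig (Site d)) :=
  {ω | ∃ S : Finset (Sym2 (Site d)), S ⊆ edgesIn (zdGraph d) (box d n) ∧ S.card ≤ k ∧
    ω ∪ ↑S ∈ DKT20.armEvent (d := d) 0 n}

/-- **`E_p[T_n]`**, the mean first-passage time from the origin to `∂Λ_n`, through the layer cake:
`Σ_{k < |F_n|} P_p(T_n > k) = Σ_{k < |F_n|} (1 − P_p(T_n ≤ k))`, `F_n = edgesIn (zdGraph d) (box d n)` (one has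
`T_n ≤ |F_n|`, so the finite sum is the full expectation). [cite: GrimmettRandomCluster2006, §2.5 (2.51)]
[cite: AuffingerDamronHanson2017, §3.7.1] -/
def meanPassTime (d n : ℕ) (p : unitInterval) : ℝ :=
  ∑ k ∈ Finset.range (edgesIn (zdGraph d) (box d n)).card, (1 - (bondPercolation (zdGraph d) p).real (passTimeLE d n k))

/-- **`{ρ ≤ k}`**: the passage time to infinity `ρ = lim_n T(0, ∂Λ_n)` (Auffinger–Damron–Hanson (3.25); Zhang 1999) is at
most `k`, i.e. `T_n ≤ k` for every `n`. [cite: AuffingerDamronHanson2017, §3.7.1 eq. (3.25)]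
[cite: ZhangDoubleBehavior1999, §1] -/
def rhoLE (d k : ℕ) : Set (BondConfig (Site d)) := ⋂ n, passTimeLE d n k

/-- **Partial sums of `E_p[ρ] = Σ_k P_p(ρ > k)`**: `meanRhoUpTo d K p = Σ_{k<K} (1 − P_p(ρ ≤ k))`; `E_p[ρ] < ∞` iff these
are bounded in `K`. [cite: AuffingerDamronHanson2017, §3.7.1 eq. (3.25)] -/
def meanRhoUpTo (d K : ℕ) (p : unitInterval) : ℝ :=
  ∑ k ∈ Finset.range K, (1 - (bondPercolation (zdGraph d) p).real (rhoLE d k))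

end PassTime

end Summit.CriticalPhenomena.PercolationContinuityZ3.Theorems

end
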